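import Mathlib.MeasureTheory.Measure.Haar.Basic
import Mathlib.MeasureTheory.Measure.Lebesgue.Basic
import Mathlib.Analysis.Real.Cardinality
import Mathlib.Topology.Algebra.Group.Basic
import HarnessLib

/-!
# Two non-proportional Haar measures on `ℝ × ℝ_discrete` (why "Radon" matters)

Topic `MeasureTheory/Group`; namespace `Literature.MeasureTheory.Group`. The classical example
behind the warning in the module docstring of `Mathlib.MeasureTheory.Measure.Haar.Unique` (to get
genuine equality of two Haar measures one typically needs regularity assumptions; without them two
Haar measures need not be proportional): on the locally compact abelian group
`G = ℝ × ℝ_d` (`ℝ_d` = the reals with the **discrete** topology, `DiscreteReal`),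

* `lineSum = Σ_y (Lebesgue measure on the line ℝ × {y})` is a Haar measure in Mathlib's sense
  (left invariant, finite on compacts, positive on opens) — `isHaarMeasure_lineSum`;
* `lineSumTop`, equal to `lineSum` on sets contained in countably many lines and to `∞` otherwise,
  is *also* a Haar measure — `isHaarMeasure_lineSumTop`;
* yet on the closed set `A = {0} × ℝ_d` (`vertical`) one has `lineSum A = 0` and
  `lineSumTop A = ∞` (`lineSum_vertical`, `lineSumTop_vertical`).

Neither measure is pathological from the point of view of `IsHaarMeasure`, and the two are not
related by any scalar in either direction (`lineSumTop_ne_smul_lineSum`,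
`lineSum_ne_smul_lineSumTop`). This is
the counterexample showing that statements quantifying over *all* Mathlib Haar measures (rather
than Radon ones, as in Deitmar–Echterhoff's standing convention Thm. 1.3.5) can fail; it is used in
`Literature/NumberTheory/Automorphic/HaarIntegralClosedCompactCounterexample.lean` to refute the
mis-stated named fact `DeitmarEchterhoff2014_prop156`.

Everything is stated for the additive group `ℝ × DiscreteReal`; the multiplicative copy
`Multiplicative (ℝ × DiscreteReal)` inherits topology and Haar measures verbatim.

## References

* Mathlib, `Mathlib/MeasureTheory/Measure/Haar/Unique.lean`, module docstring. [folklore]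
* P. R. Halmos, *Measure Theory* (1950), §58–§60 (Haar measure on non-σ-compact groups). [folklore]
-/

noncomputable section

open MeasureTheory Measure Set Topology Filter
open scoped ENNReal NNReal Pointwise

namespace Literature.MeasureTheory.Group

/-- The real numbers with the **discrete** topology (a type synonym; the additive group structure
is that of `ℝ`). [folklore] -/
def DiscreteReal : Type := ℝ

namespace DiscreteReal

/-- The additive group structure of `ℝ`. [folklore] -/
instance : AddCommGroup DiscreteReal := inferInstanceAs (AddCommGroup ℝ)
/-- The discrete topology. [folklore] -/
instance : TopologicalSpace DiscreteReal := ⊥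
/-- The topology is discrete by definition. [folklore] -/
instance : DiscreteTopology DiscreteReal := ⟨rfl⟩
/-- Every set is measurable. [folklore] -/
instance : MeasurableSpace DiscreteReal := ⊤
/-- Singletons are measurable. [folklore] -/
instance : MeasurableSingletonClass DiscreteReal := ⟨fun _ => trivial⟩
/-- `⊤` is the Borel σ-algebra of the discrete topology. [folklore] -/
instance : BorelSpace DiscreteReal := ⟨(borel_eq_top_of_discrete).symm⟩
/-- `ℝ` is uncountable. [folklore] -/
instance : Uncountable DiscreteReal := inferInstanceAs (Uncountable ℝ)
/-- `0`. [folklore] -/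
instance : Inhabited DiscreteReal := ⟨(0 : ℝ)⟩

end DiscreteReal

/-- The plane with horizontal lines glued discretely: `ℝ × ℝ_d`. [folklore] -/
abbrev LinePlane : Type := ℝ × DiscreteReal

/-- The embedding of the `y`-th horizontal line, `x ↦ (x, y)`. [folklore] -/
def line (y : DiscreteReal) : ℝ → LinePlane := fun x => (x, y)

/-- `line y` is continuous. [folklore] -/
lemma continuous_line (y : DiscreteReal) : Continuous (line y) :=
  continuous_id.prodMk continuous_const

/-- `line y` is measurable. [folklore] -/
lemma measurable_line (y : DiscreteReal) : Measurable (line y) := (continuous_line y).measurable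

/-- `line y` is a closed embedding. [folklore] -/
lemma isClosedEmbedding_line (y : DiscreteReal) : IsClosedEmbedding (line y) :=
  .of_continuous_injective_isClosedMap (continuous_line y) (fun a b h => congrArg Prod.fst h)
    (fun F hF => by
      have : line y '' F = F ×ˢ {y} := by
        ext ⟨a, b⟩; simp [line, eq_comm, and_comm]
      rw [this]
      exact hF.prod (isClosed_discrete _))

/-- **`Σ_y` Lebesgue on the lines**: `lineSum A = Σ'_y λ{x : (x, y) ∈ A}`. [folklore] -/
def lineSum : Measure LinePlane := Measure.sum fun y => Measure.map (line y) volume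

/-- Evaluation of `lineSum` on measurable sets. [folklore] -/
lemma lineSum_apply {A : Set LinePlane} (hA : MeasurableSet A) :
    lineSum A = ∑' y, volume (line y ⁻¹' A) := by
  rw [lineSum, Measure.sum_apply _ hA]
  simp_rw [Measure.map_apply (measurable_line _) hA]

/-- A set is *thin* if it lies in countably many horizontal lines. [folklore] -/
def Thin (A : Set LinePlane) : Prop := ∃ S : Set DiscreteReal, S.Countable ∧ A ⊆ Prod.snd ⁻¹' S

/-- Thin sets form a σ-ideal: subsets. [folklore] -/
lemma Thin.mono {A B : Set LinePlane} (h : A ⊆ B) (hB : Thin B) : Thin A := by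
  obtain ⟨S, hS, hBS⟩ := hB; exact ⟨S, hS, h.trans hBS⟩

/-- Thin sets form a σ-ideal: countable unions. [folklore] -/
lemma Thin.iUnion {A : ℕ → Set LinePlane} (h : ∀ n, Thin (A n)) : Thin (⋃ n, A n) := by
  choose S hS hAS using h
  exact ⟨⋃ n, S n, Set.countable_iUnion hS,
    iUnion_subset fun n => (hAS n).trans (preimage_mono (subset_iUnion S n))⟩

/-- Compact sets are thin (their projection to the discrete factor is finite). [folklore] -/
lemma Thin.of_isCompact {C : Set LinePlane} (hC : IsCompact C) : Thin C :=
  ⟨Prod.snd '' C, ((hC.image continuous_snd).finite_of_discrete).countable,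
    fun _ hp => mem_image_of_mem _ hp⟩

/-- Translates of thin sets are thin. [folklore] -/
lemma Thin.preimage_add (g : LinePlane) {A : Set LinePlane} (hA : Thin A) :
    Thin ((fun p => g + p) ⁻¹' A) := by
  obtain ⟨S, hS, hAS⟩ := hA
  refine ⟨(fun s => -g.2 + s) '' S, hS.image _, fun p hp => ?_⟩
  have : (g + p).2 ∈ S := hAS hp
  exact ⟨(g + p).2, this, by simp⟩

open Classical in
/-- **The "regularised" competitor**: `lineSumTop A = lineSum A` if `A` is thin, `= ∞` otherwise.
[folklore] -/
def lineSumTop : Measure LinePlane :=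
  Measure.ofMeasurable (fun A _ => if Thin A then lineSum A else ∞)
    (by simp [Thin.of_isCompact isCompact_empty])
    (by
      intro f hfm hdisj
      by_cases hall : ∀ n, Thin (f n)
      · rw [if_pos (Thin.iUnion hall), measure_iUnion hdisj hfm]
        exact tsum_congr fun n => by rw [if_pos (hall n)]
      · simp only [not_forall] at hall
        obtain ⟨n, hn⟩ := hall
        have hU : ¬ Thin (⋃ i, f i) := fun h => hn (h.mono (subset_iUnion f n))
        rw [if_neg hU, eq_comm]
        exact ENNReal.tsum_eq_top_of_eq_top ⟨n, by rw [if_neg hn]⟩)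

open Classical in
/-- Evaluation of `lineSumTop` on measurable sets. [folklore] -/
lemma lineSumTop_apply {A : Set LinePlane} (hA : MeasurableSet A) :
    lineSumTop A = if Thin A then lineSum A else ∞ := by
  rw [lineSumTop, Measure.ofMeasurable_apply A hA]

/-- `lineSumTop` agrees with `lineSum` on thin measurable sets. [folklore] -/
lemma lineSumTop_apply_of_thin {A : Set LinePlane} (hA : MeasurableSet A) (h : Thin A) :
    lineSumTop A = lineSum A := by
  classical
  rw [lineSumTop_apply hA, if_pos h]

/-- `lineSum ≤ lineSumTop` on measurable sets. [folklore] -/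
lemma lineSum_le_lineSumTop {A : Set LinePlane} (hA : MeasurableSet A) : lineSum A ≤ lineSumTop A := by
  classical
  rw [lineSumTop_apply hA]
  split_ifs
  · exact le_rfl
  · exact le_top

/-! ### Both are Haar measures -/

/-- `lineSum` is finite on compact sets. [folklore] -/
instance isFiniteMeasureOnCompacts_lineSum : IsFiniteMeasureOnCompacts lineSum := by
  refine ⟨fun C hC => ?_⟩
  rw [lineSum_apply hC.measurableSet]
  have hfin : (Prod.snd '' C).Finite := (hC.image continuous_snd).finite_of_discrete
  rw [tsum_eq_sum (s := hfin.toFinset) (fun y hy => ?_)]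
  · refine ENNReal.sum_lt_top.mpr fun y _ => ?_
    exact ((isClosedEmbedding_line y).isCompact_preimage hC).measure_lt_top
  · have : line y ⁻¹' C = ∅ := by
      ext x
      simp only [mem_preimage, mem_empty_iff_false, iff_false]
      intro hx
      exact hy (hfin.mem_toFinset.mpr ⟨(x, y), hx, rfl⟩)
    rw [this, measure_empty]

/-- `lineSum` is positive on nonempty open sets. [folklore] -/
instance isOpenPosMeasure_lineSum : IsOpenPosMeasure lineSum := by
  refine ⟨fun U hU ⟨p, hp⟩ => ?_⟩
  rw [lineSum_apply hU.measurableSet]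
  refine ne_of_gt (lt_of_lt_of_le ?_ (ENNReal.le_tsum p.2))
  have hopen : IsOpen (line p.2 ⁻¹' U) := hU.preimage (continuous_line _)
  exact hopen.measure_pos volume ⟨p.1, by simpa [line] using hp⟩

/-- `lineSum` is translation invariant. [folklore] -/
instance isAddLeftInvariant_lineSum : lineSum.IsAddLeftInvariant := by
  refine ⟨fun g => ?_⟩
  ext A hA
  rw [Measure.map_apply (measurable_const_add g) hA, lineSum_apply hA,
    lineSum_apply ((measurable_const_add g) hA)]
  have hpre : ∀ y, line y ⁻¹' ((fun p => g + p) ⁻¹' A) =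
      (fun x => g.1 + x) ⁻¹' (line (g.2 + y) ⁻¹' A) := by
    intro y; ext x; exact Iff.rfl
  simp_rw [hpre, measure_preimage_add]
  exact (Equiv.addLeft g.2).tsum_eq (fun y => volume (line y ⁻¹' A))

/-- **`lineSum` is a Haar measure** on `ℝ × ℝ_d` (Mathlib's sense). [folklore] -/
instance isAddHaarMeasure_lineSum : lineSum.IsAddHaarMeasure where

/-- `lineSumTop` is finite on compact sets (compact sets are thin). [folklore] -/
instance isFiniteMeasureOnCompacts_lineSumTop : IsFiniteMeasureOnCompacts lineSumTop :=
  ⟨fun C hC => by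
    rw [lineSumTop_apply_of_thin hC.measurableSet (Thin.of_isCompact hC)]
    exact hC.measure_lt_top⟩

/-- `lineSumTop` is positive on nonempty open sets. [folklore] -/
instance isOpenPosMeasure_lineSumTop : IsOpenPosMeasure lineSumTop :=
  ⟨fun _ hU hne => ne_of_gt (lt_of_lt_of_le ((hU.measure_pos lineSum hne))
    (lineSum_le_lineSumTop hU.measurableSet))⟩

/-- `lineSumTop` is translation invariant. [folklore] -/
instance isAddLeftInvariant_lineSumTop : lineSumTop.IsAddLeftInvariant := by
  classical
  refine ⟨fun g => ?_⟩
  ext A hA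
  have hA' : MeasurableSet ((fun p => g + p) ⁻¹' A) := (measurable_const_add g) hA
  rw [Measure.map_apply (measurable_const_add g) hA, lineSumTop_apply hA, lineSumTop_apply hA']
  have hiff : Thin ((fun p => g + p) ⁻¹' A) ↔ Thin A := by
    refine ⟨fun h => ?_, Thin.preimage_add g⟩
    have := h.preimage_add (-g)
    simpa [preimage_preimage] using this
  rw [if_congr hiff ?_ rfl]
  rw [← Measure.map_apply (measurable_const_add g) hA, map_add_left_eq_self]

/-- **`lineSumTop` is a Haar measure** on `ℝ × ℝ_d` (Mathlib's sense) as well. [folklore] -/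
instance isAddHaarMeasure_lineSumTop : lineSumTop.IsAddHaarMeasure where

/-! ### The vertical line separates them -/

/-- The vertical line `{0} × ℝ_d`. [folklore] -/
def vertical : Set LinePlane := Prod.fst ⁻¹' {0}

/-- The vertical line is closed. [folklore] -/
lemma isClosed_vertical : IsClosed vertical := isClosed_singleton.preimage continuous_fst

/-- The vertical line is not thin (`ℝ` is uncountable). [folklore] -/
lemma not_thin_vertical : ¬ Thin vertical := by
  rintro ⟨S, hS, hAS⟩
  have : (univ : Set DiscreteReal) ⊆ S := fun y _ => hAS (show ((0 : ℝ), y) ∈ vertical from rfl)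
  exact not_countable_univ (hS.mono this)

/-- `lineSum (vertical) = 0`: every horizontal line meets it in one point. [folklore] -/
lemma lineSum_vertical : lineSum vertical = 0 := by
  rw [lineSum_apply isClosed_vertical.measurableSet]
  have : ∀ y, line y ⁻¹' vertical = {0} := fun y => by ext x; simp [line, vertical]
  simp [this]

/-- `lineSumTop (vertical) = ∞`. [folklore] -/
lemma lineSumTop_vertical : lineSumTop vertical = ∞ := by
  classical
  rw [lineSumTop_apply isClosed_vertical.measurableSet, if_neg not_thin_vertical]

/-- **Non-proportionality**: no scalar `c` satisfies `lineSumTop = c • lineSum`, although both are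
Haar measures on the same locally compact group. [folklore] -/
theorem lineSumTop_ne_smul_lineSum (c : ℝ≥0∞) : lineSumTop ≠ c • lineSum := by
  intro h
  have := congrArg (fun m : Measure LinePlane => m vertical) h
  simp [lineSumTop_vertical, lineSum_vertical] at this

/-- **Non-proportionality, converse direction**: no scalar `c` satisfies `lineSum = c • lineSumTop`
either (`c = 0` contradicts positivity on open sets, `c ≠ 0` gives `∞` on the vertical line).
[folklore] -/
theorem lineSum_ne_smul_lineSumTop (c : ℝ≥0∞) : lineSum ≠ c • lineSumTop := by
  intro h
  rcases eq_or_ne c 0 with rfl | hc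
  · have h1 : lineSum univ = 0 := by rw [h]; simp
    exact (isOpen_univ.measure_pos lineSum univ_nonempty).ne' h1
  · have := congrArg (fun m : Measure LinePlane => m vertical) h
    simp [lineSumTop_vertical, lineSum_vertical, hc] at this

end Literature.MeasureTheory.Group
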